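import Summits.KontsevichZagierPeriods.KontsevichZagierPeriods.Theorems.FermatIsogenyBetaLinearSectorStubSectorChartAux
import Mathlib.Analysis.SpecialFunctions.Pow.Deriv
import Mathlib.Analysis.SpecialFunctions.Complex.Analytic
import Mathlib.RingTheory.Algebraic.Integral
import HarnessLib

/-!
# `BetaLinearSector` (stmt-KontsevichZagierPeriods-3897), line `fermat-sector-transport`:
# auxiliaries for SECTOR STUB P `stub_sectorPaths` (the seven sector paths on the Fermat curve)

General lemmas (no path `γ` in the statements) used to build the auxiliary sector paths
`e₂, f, e₃, d₃, fI, γ₁, γ₂` on the affine Fermat curve `F_N = {x^N + y^N = 1}` as `CurvePath`s: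

* the quotient rule for `ℂ`-valued `C¹` maps of a real variable;
* the algebra of the automorphisms `g₂(x,y) = (1/x, εy/x)`, `g₃(x,y) = (ε̄x/y, 1/y)`:
  `x^N + y^N = 1`, `η^N = −1`, `x ≠ 0` ⇒ `(1/x)^N + (η y/x)^N = 1`;
* algebraicity of `2^{1/N}`, `ε = e^{iπ/N}`, `ε̄ = e^{−iπ/N}` and of the entries of `![a, b]`;
* the radial arc `γ_N(t) = Q^{−1/N}(1−t, t)`: positivity of the coordinates and the mid point value
  `γ_N(1/2) = (2^{−1/N}, 2^{−1/N})`;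
* the frontier `x_f(t) = (2−t)^{1/N} e^{iπt/N}`: `C¹` for `t < 2`, nonvanishing, the base
  `i(1 − x_f^N) = (2−t) sin πt + i(1 − (2−t) cos πt)` of the sector chart lies in the slit plane for
  `t ∈ [0,1]`, so `Y(x_f(t)) = exp(−iπ/(2N)) (i(1 − x_f^N))^{1/N}` is `C¹` on `[0,1]`
  (`AnalyticAt.cpow`), and the end point values `x_f(0) = 2^{1/N}`, `x_f(1) = ε`, `Y(2^{1/N}) = ε̄`,
  `Y(ε) = 2^{1/N}`.

References: B. Gross, *On the periods of abelian integrals and a formula of Chowla and Selberg*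
(1978), §1 (with Rohrlich's appendix); A. Huber, G. Wüstholz, *Transcendence and Linear Relations of
1-Periods* (2022), §3.3.1.  Folklore calculus; no definition, no named fact.
-/

noncomputable section

open scoped BigOperators unitInterval
open MeasureTheory Set MvPolynomial
open Literature.NumberTheory.Transcendental Literature.NumberTheory.Transcendental.CurvePeriods

namespace Summit.KontsevichZagierPeriods.FermatIsogeny.BetaLinearSector

/-! ## Calculus and algebra helpers -/

/-- Quotient rule: `f/g` is `C¹` on `s` for `ℂ`-valued `C¹` maps of a real variable with `g ≠ 0` on `s`.
[folklore] -/
theorem sectorPaths_contDiffOn_div {f g : ℝ → ℂ} {s : Set ℝ} (hf : ContDiffOn ℝ 1 f s)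
    (hg : ContDiffOn ℝ 1 g s) (h : ∀ x ∈ s, g x ≠ 0) : ContDiffOn ℝ 1 (fun x => f x / g x) s := by
  simpa only [div_eq_mul_inv] using hf.mul (hg.fun_inv h)

/-- The automorphism algebra: `x^N + y^N = 1`, `η^N = −1`, `x ≠ 0` ⇒ `(1/x)^N + (η y/x)^N = 1`
(`g₂`, `g₃` preserve the Fermat curve). [cite: Gross1978, §1] -/
theorem sectorPaths_inv_pow_add {N : ℕ} {x y η : ℂ} (hx : x ≠ 0) (h : x ^ N + y ^ N = 1)
    (hη : η ^ N = -1) : (x⁻¹) ^ N + (η * y / x) ^ N = 1 := by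
  have hxN : x ^ N ≠ 0 := pow_ne_zero N hx
  have e1 : (x⁻¹) ^ N + (η * y / x) ^ N = (1 + η ^ N * y ^ N) / x ^ N := by
    rw [div_pow, mul_pow, inv_pow, add_div, one_div]
  rw [e1, hη, div_eq_one_iff_eq hxN]
  linear_combination -h

/-- The entries of `![a, b]` are algebraic if `a`, `b` are. [folklore] -/
theorem sectorPaths_algebraic_vec {v : Fin 2 → ℂ} {a b : ℂ} (h : v = ![a, b])
    (ha : IsAlgebraic ℚ a) (hb : IsAlgebraic ℚ b) : ∀ i, IsAlgebraic ℚ (v i) := by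
  intro i
  rw [h]
  fin_cases i
  · simpa using ha
  · simpa using hb

/-- `2^{1/N}` is algebraic (a root of `X^N − 2`). [folklore] -/
theorem sectorPaths_algebraic_root {N : ℕ} (hN : N ≠ 0) :
    IsAlgebraic ℚ ((((2:ℝ) ^ ((N:ℝ)⁻¹) : ℝ) : ℂ)) := by
  refine IsAlgebraic.of_pow (Nat.pos_of_ne_zero hN) ?_
  rw [← Complex.ofReal_pow, Real.rpow_inv_natCast_pow zero_le_two hN, Complex.ofReal_ofNat]
  exact_mod_cast (isAlgebraic_nat 2 : IsAlgebraic ℚ ((2:ℕ) : ℂ))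

/-- `ε = e^{iπ/N}` is algebraic (`ε^N = −1`). [folklore] -/
theorem sectorPaths_algebraic_eps {N : ℕ} (hN : N ≠ 0) :
    IsAlgebraic ℚ (Complex.exp (↑Real.pi * Complex.I / (N : ℂ))) :=
  IsAlgebraic.of_pow (Nat.pos_of_ne_zero hN) (by rw [sectorChart_eps_pow hN]; exact isAlgebraic_one.neg)

/-- `ε̄ = e^{−iπ/N}` is algebraic (`ε̄^N = −1`). [folklore] -/
theorem sectorPaths_algebraic_epsBar {N : ℕ} (hN : N ≠ 0) :
    IsAlgebraic ℚ (Complex.exp (-(↑Real.pi * Complex.I / (N : ℂ)))) :=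
  IsAlgebraic.of_pow (Nat.pos_of_ne_zero hN)
    (by rw [sectorChart_epsBar_pow hN]; exact isAlgebraic_one.neg)

/-! ## The radial arc -/

/-- `γ_x(t) = (1−t) Q^{−1/N} > 0` for `t < 1`. [folklore] -/
theorem sectorPaths_arcA_pos {N : ℕ} (hN : 1 ≤ N) {t : ℝ} (ht : t < 1) :
    0 < (1 - t) * ((1 - t) ^ N + t ^ N) ^ (-(1:ℝ) / N) :=
  mul_pos (by linarith) (Real.rpow_pos_of_pos (fermatQ_pos hN t) _)

/-- `γ_y(t) = t Q^{−1/N} > 0` for `0 < t`. [folklore] -/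
theorem sectorPaths_arcB_pos {N : ℕ} (hN : 1 ≤ N) {t : ℝ} (ht : 0 < t) :
    0 < t * ((1 - t) ^ N + t ^ N) ^ (-(1:ℝ) / N) :=
  mul_pos ht (Real.rpow_pos_of_pos (fermatQ_pos hN t) _)

/-- The mid point of the arc: `(1/2)·(2·2^{−N})^{−1/N} = 2^{−1/N}` (both sides are positive with
`N`-th power `1/2`). [folklore] -/
theorem sectorPaths_arc_half {N : ℕ} (hN : 1 ≤ N) :
    (1 / 2 : ℝ) * ((1 / 2 : ℝ) ^ N + (1 / 2 : ℝ) ^ N) ^ (-(1:ℝ) / N) = ((2:ℝ) ^ ((N:ℝ)⁻¹))⁻¹ := by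
  have hN0 : N ≠ 0 := by omega
  have hNr : (N : ℝ) ≠ 0 := Nat.cast_ne_zero.2 hN0
  have hq : (0:ℝ) < (1 / 2 : ℝ) ^ N + (1 / 2 : ℝ) ^ N := by positivity
  have hs : 0 < ((1 / 2 : ℝ) ^ N + (1 / 2 : ℝ) ^ N) ^ (-(1:ℝ) / N) := Real.rpow_pos_of_pos hq _
  have hr : (0:ℝ) < (2:ℝ) ^ ((N:ℝ)⁻¹) := Real.rpow_pos_of_pos two_pos _
  have hrN : ((2:ℝ) ^ ((N:ℝ)⁻¹)) ^ N = 2 := Real.rpow_inv_natCast_pow zero_le_two hN0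
  have hsN : (((1 / 2 : ℝ) ^ N + (1 / 2 : ℝ) ^ N) ^ (-(1:ℝ) / N)) ^ N =
      ((1 / 2 : ℝ) ^ N + (1 / 2 : ℝ) ^ N)⁻¹ := by
    rw [← Real.rpow_natCast, ← Real.rpow_mul hq.le, div_mul_cancel₀ _ hNr, Real.rpow_neg_one]
  rw [← pow_left_inj₀ (by positivity) (inv_nonneg.2 hr.le) hN0, mul_pow, inv_pow, hrN, hsN]
  field_simp
  ring

/-! ## The frontier `x_f(t) = (2−t)^{1/N} e^{iπt/N}` and `Y(x_f(t))` -/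

/-- `x_f` is `C¹` at every `t < 2`. [folklore] -/
theorem sectorPaths_frontier_contDiffAt (N : ℕ) {t : ℝ} (ht : t < 2) :
    ContDiffAt ℝ 1 (fun t : ℝ => ((((2:ℝ) - t) ^ ((N:ℝ)⁻¹) : ℝ) : ℂ) *
      Complex.exp (↑Real.pi * Complex.I * (t : ℂ) / (N : ℂ))) t := by
  have h0 : ContDiff ℝ 1 (fun t : ℝ => (2:ℝ) - t) := contDiff_const.sub contDiff_id
  have h1 : ContDiffAt ℝ 1 (fun t : ℝ => ((2:ℝ) - t) ^ ((N:ℝ)⁻¹)) t :=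
    h0.contDiffAt.rpow_const_of_ne (by show (2:ℝ) - t ≠ 0; linarith)
  have h2 : ContDiffAt ℝ 1 (fun t : ℝ => ((((2:ℝ) - t) ^ ((N:ℝ)⁻¹) : ℝ) : ℂ)) t :=
    Complex.ofRealCLM.contDiff.contDiffAt.comp t h1
  have h3 : ContDiff ℝ 1 (fun t : ℝ => Complex.exp (↑Real.pi * Complex.I * (t : ℂ) / (N : ℂ))) :=
    Complex.contDiff_exp.comp ((contDiff_const.mul Complex.ofRealCLM.contDiff).div_const _)
  exact h2.mul h3.contDiffAt

/-- `x_f(t) ≠ 0` for `t < 2`. [folklore] -/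
theorem sectorPaths_frontier_ne_zero (N : ℕ) {t : ℝ} (ht : t < 2) :
    ((((2:ℝ) - t) ^ ((N:ℝ)⁻¹) : ℝ) : ℂ) * Complex.exp (↑Real.pi * Complex.I * (t : ℂ) / (N : ℂ)) ≠ 0 :=
  mul_ne_zero (Complex.ofReal_ne_zero.2 (Real.rpow_pos_of_pos (by linarith) _).ne')
    (Complex.exp_ne_zero _)

/-- For `t ∈ [0,1]` the base `i(1 − x_f(t)^N) = (2−t) sin πt + i(1 − (2−t) cos πt)` of the sector
chart lies in the slit plane (positive real part for `0 < t < 1`; imaginary part `−1`, `2` at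
`t = 0, 1`). [folklore] -/
theorem sectorPaths_frontier_slit {N : ℕ} (hN : N ≠ 0) {t : ℝ} (ht : t ∈ Set.Icc (0:ℝ) 1) :
    Complex.I * (1 - (((((2:ℝ) - t) ^ ((N:ℝ)⁻¹) : ℝ) : ℂ) *
      Complex.exp (↑Real.pi * Complex.I * (t : ℂ) / (N : ℂ))) ^ N) ∈ Complex.slitPlane := by
  rw [sectorChart_frontier_pow hN (by linarith [ht.2] : t ≤ 2), Complex.mem_slitPlane_iff]
  have hc := Complex.exp_ofReal_mul_I_re (Real.pi * t)
  have hs := Complex.exp_ofReal_mul_I_im (Real.pi * t)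
  generalize Complex.exp (((Real.pi * t : ℝ) : ℂ) * Complex.I) = w at hc hs ⊢
  have hre : (Complex.I * (1 - ((((2:ℝ) - t) : ℝ) : ℂ) * w)).re = (2 - t) * Real.sin (Real.pi * t) := by
    simp [hc, hs]
  have him : (Complex.I * (1 - ((((2:ℝ) - t) : ℝ) : ℂ) * w)).im = 1 - (2 - t) * Real.cos (Real.pi * t) := by
    simp [hc, hs]
  rw [hre, him]
  rcases eq_or_lt_of_le ht.1 with h0 | h0
  · right
    rw [← h0]
    norm_num
  rcases eq_or_lt_of_le ht.2 with h1 | h1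
  · right
    rw [h1]
    norm_num
  · left
    exact mul_pos (by linarith) (Real.sin_pos_of_pos_of_lt_pi (by positivity)
      (by nlinarith [Real.pi_pos]))

/-- `Y(x_f(t)) = exp(−iπ/(2N)) (i(1 − x_f(t)^N))^{1/N}` is `C¹` at every `t ∈ [0,1]` (principal power
of a base in the slit plane). [folklore] -/
theorem sectorPaths_frontierY_contDiffAt {N : ℕ} (hN : N ≠ 0) {t : ℝ} (ht : t ∈ Set.Icc (0:ℝ) 1) :
    ContDiffAt ℝ 1 (fun t : ℝ => Complex.exp (-(↑Real.pi * Complex.I / (2 * (N : ℂ)))) *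
      (Complex.I * (1 - (((((2:ℝ) - t) ^ ((N:ℝ)⁻¹) : ℝ) : ℂ) *
        Complex.exp (↑Real.pi * Complex.I * (t : ℂ) / (N : ℂ))) ^ N)) ^ ((N : ℂ)⁻¹)) t := by
  have hx := sectorPaths_frontier_contDiffAt N (by linarith [ht.2] : t < 2)
  have hin : ContDiffAt ℝ 1 (fun t : ℝ => Complex.I * (1 - (((((2:ℝ) - t) ^ ((N:ℝ)⁻¹) : ℝ) : ℂ) *
      Complex.exp (↑Real.pi * Complex.I * (t : ℂ) / (N : ℂ))) ^ N)) t :=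
    contDiffAt_const.mul (contDiffAt_const.sub (hx.pow N))
  have hout : AnalyticAt ℂ (fun w : ℂ => w ^ ((N : ℂ)⁻¹))
      (Complex.I * (1 - (((((2:ℝ) - t) ^ ((N:ℝ)⁻¹) : ℝ) : ℂ) *
        Complex.exp (↑Real.pi * Complex.I * (t : ℂ) / (N : ℂ))) ^ N)) :=
    analyticAt_id.cpow analyticAt_const (sectorPaths_frontier_slit hN ht)
  have hcomp := ((hout.contDiffAt (n := 1)).restrict_scalars ℝ).comp t hin
  exact contDiffAt_const.mul hcomp

/-- `x_f(0) = 2^{1/N}`. [folklore] -/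
theorem sectorPaths_frontier_zero (N : ℕ) :
    ((((2:ℝ) - 0) ^ ((N:ℝ)⁻¹) : ℝ) : ℂ) * Complex.exp (↑Real.pi * Complex.I * ((0:ℝ) : ℂ) / (N : ℂ)) =
      (((2:ℝ) ^ ((N:ℝ)⁻¹) : ℝ) : ℂ) := by
  simp

/-- `x_f(1) = ε`. [folklore] -/
theorem sectorPaths_frontier_one (N : ℕ) :
    ((((2:ℝ) - 1) ^ ((N:ℝ)⁻¹) : ℝ) : ℂ) * Complex.exp (↑Real.pi * Complex.I * ((1:ℝ) : ℂ) / (N : ℂ)) =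
      Complex.exp (↑Real.pi * Complex.I / (N : ℂ)) := by
  rw [show (2:ℝ) - 1 = 1 by norm_num, Real.one_rpow, Complex.ofReal_one, one_mul, mul_one]

/-- `Y(2^{1/N}) = ε̄` (base `i(1 − 2) = −i`). [cite: Gross1978, §1] -/
theorem sectorPaths_Y_root {N : ℕ} (hN : N ≠ 0) :
    Complex.exp (-(↑Real.pi * Complex.I / (2 * (N : ℂ)))) *
        (Complex.I * (1 - ((((2:ℝ) ^ ((N:ℝ)⁻¹) : ℝ) : ℂ)) ^ N)) ^ ((N : ℂ)⁻¹) =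
      Complex.exp (-(↑Real.pi * Complex.I / (N : ℂ))) := by
  have haN : ((2:ℝ) ^ ((N:ℝ)⁻¹)) ^ N = 2 := Real.rpow_inv_natCast_pow zero_le_two hN
  have h1 : (1 : ℂ) - (((2:ℝ) ^ ((N:ℝ)⁻¹) : ℝ) : ℂ) ^ N = -(((1:ℝ)) : ℂ) := by
    rw [← Complex.ofReal_pow, haN]
    push_cast
    norm_num
  rw [h1, sectorChart_root_neg hN zero_le_one, Real.one_rpow, Complex.ofReal_one, mul_one]

/-- `Y(ε) = 2^{1/N}` (base `i(1 − ε^N) = 2i`). [cite: Gross1978, §1] -/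
theorem sectorPaths_Y_eps {N : ℕ} (hN : N ≠ 0) :
    Complex.exp (-(↑Real.pi * Complex.I / (2 * (N : ℂ)))) *
        (Complex.I * (1 - (Complex.exp (↑Real.pi * Complex.I / (N : ℂ))) ^ N)) ^ ((N : ℂ)⁻¹) =
      (((2:ℝ) ^ ((N:ℝ)⁻¹) : ℝ) : ℂ) := by
  rw [sectorChart_eps_pow hN, show (1 : ℂ) - -1 = ((2:ℝ) : ℂ) by push_cast; norm_num,
    sectorChart_root_pos hN zero_le_two]

end Summit.KontsevichZagierPeriods.FermatIsogeny.BetaLinearSector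

end
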